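import Literature.Probability.LatticeModels.BackboneKernel
import HarnessLib

/-!
# Aizenman–Fernández's Lemma 5.5: the effect of removing a cluster on the magnetisation

Topic `Probability/LatticeModels`, namespace `Literature.Probability.LatticeModels`. Fifth layer of
the proof of the Aizenman–Fernández differential inequalities (J. Stat. Phys. 44 (1986) 393–454):
**Lemma 5.5, eq. (5.15)**, in the `θ`-systems of `FieldCurrentsTheta` and for the retained regions
`S ∋ g` of `FieldCurrentsClusters` (`corrIn θ S`, the system deprived of every bond meeting the
"cluster" `C = (Λ ∪ {g}) ∖ S`):

`⟨σ_v⟩_θ - ⟨σ_v⟩_S ≤ ∑_{k ∈ C} K(v,k) · [tanh θ_{kg} + ∑_{l} tanh θ_{kl} ⟨σ_l⟩_S]`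

(`thetaCorr_singleton_sub_corrIn_le`), with the backbone kernel `K = bbKernel` of `BackboneKernel`
(for which `0 ≤ K(v,k) ≤ ⟨σ_vσ_k⟩_{h=0}`, Prop. 4.7). The proof is the printed one
(eqs. (5.16)–(5.18)): write `⟨σ_v⟩ = ∑_{∂F = {v,g}} ∏ tanh / g(∅)` and classify `F` by the last
visit of its backbone `v → g` to `C`: no visit at all (these weigh at most `g(∅) ⟨σ_v⟩_S`, by the
avoidance bound of Prop. 4.4 (e)–(f)); last visit at `k ∈ C` followed by the step to the ghost
(weight `≤ tanh θ_{kg} K(v,k) g(∅)` by the surgery of Prop. 4.6: removing that step leaves a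
backbone `v → k` reaching `k` first); last visit at `k` followed by a lattice step to `l ∉ C`
(weight `≤ tanh θ_{kl} K(v,k) g(∅) ⟨σ_l⟩_S`: the continuation `l → g` avoids `C`).

Everything is proved; there are no named facts.

## References

* M. Aizenman, R. Fernández, J. Stat. Phys. 44 (1986) 393–454: §5.1, Lemma 5.5, eqs. (5.15)–(5.18);
  §4.2–4.3, Props. 4.4, 4.6, 4.7 [AizenmanFernandezJSP1986] (held: `paper:url-b8cebc3f44bb`).
-/

noncomputable section

open Finset MeasureTheory
open scoped symmDiff ENNReal

namespace Literature.Probability.LatticeModels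

variable {V : Type*} [DecidableEq V]

section Deficit

variable {G : SimpleGraph V} [G.LocallyFinite] {Λ : Finset V}

local notation "Gg" => ghostGraph G Λ
local notation "Λg" => Finset.insertNone Λ
local notation "Eg" => edgesIn (ghostGraph G Λ) (Finset.insertNone Λ)
local notation "gS[" θ ", " E' ", " B "]" => ghteSum (Finset.insertNone Λ) θ E' B

variable (rk : Sym2 (Option V) → ℕ)

/-! ### Helpers: positions, the end of a `{v,g}`-walk, the pairs at a cluster -/

/-- The walk from a vertex of `Λ ∪ {g}` stays in `Λ ∪ {g}`. [folklore] -/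
theorem ewIter_pos_mem (F : Finset (Sym2 (Option V))) (T : Finset (Option V)) {v₀ : Option V} (hv₀ : v₀ ∈ Λg)
    (n : ℕ) : (ewIter Eg rk F T (ewInit v₀) n).pos ∈ Λg := by
  induction n with
  | zero => exact hv₀
  | succ n ih =>
    set σ := ewIter Eg rk F T (ewInit v₀) n with hσ
    rw [ewIter_succ, ← hσ]
    rcases ewStep_cases (E := Eg) (rk := rk) F T σ with ⟨-, hs⟩ | ⟨-, -, hs⟩ | ⟨hh, hT, hA, hs⟩ | ⟨-, -, -, hs⟩
    · rw [hs]; exact ih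
    · rw [hs]; exact ih
    · obtain ⟨hstep, heE, hpe, -, -, -⟩ := ewStep_traverse_spec (E := Eg) (rk := rk) hh hT hA
      rw [hstep]
      exact (mem_edgesIn_iff.1 heE).2 _ (edgeOther_mem hpe)
    · rw [hs]; exact ih

/-- **A `{v,g}`-backbone ends at the ghost**: for `F ⊆ ℰ⁺_Λ` with odd vertices `{v, g}` the walk
from `v` with stopping set `{g}` ends at `g` (Def. 4.2 (P3)). [cite: AizenmanFernandezJSP1986, §4.1, Definition 4.2 (P3)] -/
theorem ewRun_pos_eq_none (hrk : Set.InjOn rk ↑(Eg)) {F : Finset (Sym2 (Option V))} (hF : F ⊆ Eg) {v : V}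
    (hodd : oddVerts Λg F = ({some v} ∆ {none} : Finset (Option V))) :
    (ewRun Eg rk F {none} (some v)).pos = none := by
  have hFE : F ∩ Eg = F := inter_eq_left.2 hF
  have hdeg : ∀ p : Option V, Odd #((F ∩ Eg).filter fun e => p ∈ e) → p ∈ oddVerts Λg F := by
    intro p hp
    rw [hFE] at hp
    rw [oddVerts, mem_filter]
    refine ⟨?_, hp⟩
    -- a vertex with an edge of `F ⊆ ℰ⁺` at it lies in `Λ ∪ {g}`
    have hne : (F.filter fun e => p ∈ e).Nonempty := by
      rw [← card_pos]; exact hp.pos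
    obtain ⟨e, he⟩ := hne
    rw [mem_filter] at he
    exact (mem_edgesIn_iff.1 (hF he.1)).2 p he.2
  have h := ewRun_pos_mem hrk (fun e he => not_isDiag_of_mem_edgesIn_ghost (G := G) (Λ := Λ) he)
    (F := F) (T := ({none} : Finset (Option V))) (v := some v) ?_ ?_
  · exact mem_singleton.1 h
  · intro p hp
    have := hdeg p hp
    rw [hodd, mem_symmDiff, mem_singleton, mem_singleton] at this
    rcases this with ⟨h1, -⟩ | ⟨h1, -⟩
    · exact Or.inl h1
    · exact Or.inr (mem_singleton.2 h1)
  · left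
    rw [hFE]
    have : (some v : Option V) ∈ oddVerts Λg F := by
      rw [hodd, mem_symmDiff]; exact Or.inl ⟨mem_singleton_self _, fun h => Option.some_ne_none v (mem_singleton.1 h)⟩
    exact (mem_filter.1 this).2

/-- The pairs of `ℰ⁺_Λ` not inside `S ⊆ Λ ∪ {g}` are the pairs meeting `(Λ ∪ {g}) ∖ S`. [folklore] -/
theorem sdiff_edgesIn_eq_edgesMeeting (S : Finset (Option V)) :
    Eg \ edgesIn Gg S = edgesMeeting (G := G) (Λ := Λ) (Λg \ S) := by
  ext e
  rw [mem_sdiff, mem_edgesMeeting, mem_edgesIn_iff, mem_edgesIn_iff]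
  constructor
  · rintro ⟨⟨he, hmem⟩, hnot⟩
    refine ⟨⟨he, hmem⟩, ?_⟩
    by_contra hcon
    simp only [not_exists, not_and] at hcon
    exact hnot ⟨he, fun x hx => by
      by_contra hxS
      exact hcon x (mem_sdiff.2 ⟨hmem x hx, hxS⟩) hx⟩
  · rintro ⟨⟨he, hmem⟩, w, hw, hwe⟩
    exact ⟨⟨he, hmem⟩, fun h => (mem_sdiff.1 hw).2 (h.2 w hwe)⟩

/-- **The depleted correlations as high-temperature ratios**: for `S ⊆ Λ ∪ {g}`, `A ⊆ Λ` and
`D` the pairs meeting `(Λ ∪ {g}) ∖ S`, `⟨σ_A⟩_S = g_{ℰ⁺∖D}(A*)/g_{ℰ⁺∖D}(∅)`. [cite: AizenmanFernandezJSP1986, §4.2, eq. (4.13)] -/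
theorem corrIn_eq_ghteSum_div (θ : Sym2 (Option V) → ℝ) (S : Finset (Option V)) {A : Finset V}
    (hA : A ⊆ Λ) :
    corrIn G Λ θ S A = gS[θ, Eg \ edgesMeeting (G := G) (Λ := Λ) (Λg \ S), starSet A] /
      gS[θ, Eg \ edgesMeeting (G := G) (Λ := Λ) (Λg \ S), ∅] := by
  have hDE : edgesMeeting (G := G) (Λ := Λ) (Λg \ S) ⊆ Eg := filter_subset _ _
  rw [corrIn, sdiff_edgesIn_eq_edgesMeeting S,
    show edgesMeeting (G := G) (Λ := Λ) (Λg \ S) = Eg \ (Eg \ edgesMeeting (G := G) (Λ := Λ) (Λg \ S)) from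
      (Finset.sdiff_sdiff_eq_self hDE).symm,
    thetaCorr_cplOff_sdiff_eq_ghteSum_div θ sdiff_subset hA, Finset.sdiff_sdiff_eq_self hDE]

/-- Depleting more: `⟨σ_A⟩_{cplOff θ (U ∪ D)} ≤ ⟨σ_A⟩_S` as a ratio inequality, `D` the pairs
meeting `(Λ ∪ {g}) ∖ S`, `U ⊆ ℰ⁺_Λ`. [cite: AizenmanFernandezJSP1986, §5.1, proof of Lemma 5.5, the Griffiths II step in (5.18)] -/
theorem ghteSum_div_le_corrIn {θ : Sym2 (Option V) → ℝ} (hθ : ∀ e, 0 ≤ θ e) (S : Finset (Option V))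
    {U : Finset (Sym2 (Option V))} (hU : U ⊆ Eg) {A : Finset V} (hA : A ⊆ Λ) :
    gS[θ, Eg \ (U ∪ edgesMeeting (G := G) (Λ := Λ) (Λg \ S)), starSet A] /
        gS[θ, Eg \ (U ∪ edgesMeeting (G := G) (Λ := Λ) (Λg \ S)), ∅] ≤ corrIn G Λ θ S A := by
  set D := edgesMeeting (G := G) (Λ := Λ) (Λg \ S) with hD
  have hDE : D ⊆ Eg := filter_subset _ _
  have hUD : U ∪ D ⊆ Eg := union_subset hU hDE
  rw [← thetaCorr_cplOff_sdiff_eq_ghteSum_div θ sdiff_subset hA, Finset.sdiff_sdiff_eq_self hUD, corrIn,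
    sdiff_edgesIn_eq_edgesMeeting S, ← hD]
  exact thetaCorr_cplOff_anti hθ subset_union_right hA

/-! ### The three classes of backbones -/

/-- **Class (P1): backbones `v → g` that never visit the cluster** weigh at most `g(∅) ⟨σ_v⟩_S`
(the avoidance bound from the start). [cite: AizenmanFernandezJSP1986, §5.1, proof of Lemma 5.5, first term of (5.18)] -/
theorem sum_tw_noVisit_le {θ : Sym2 (Option V) → ℝ} (hθ : ∀ e, 0 ≤ θ e) (hrk : Set.InjOn rk ↑(Eg))
    (S : Finset (Option V)) {v : V} (hv : v ∈ Λ) (𝓑 : Finset (Finset (Sym2 (Option V))))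
    (h𝓑 : ∀ F ∈ 𝓑, F ⊆ Eg ∧ oddVerts Λg F = ({some v} ∆ {none} : Finset (Option V)) ∧
      ∀ m, (ewIter Eg rk F {none} (ewInit (some v)) m).pos ∉ Λg \ S) :
    ∑ F ∈ 𝓑, tw θ F ≤ gS[θ, Eg, ∅] * corrIn G Λ θ S {v} := by
  have hvg : (some v : Option V) ∈ Λg := Finset.some_mem_insertNone.2 hv
  have hng : (none : Option V) ∈ Λg := Finset.none_mem_insertNone
  set D := edgesMeeting (G := G) (Λ := Λ) (Λg \ S) with hD
  have key := sum_tw_avoid_le rk hθ hrk ∅ {none} hvg (Nat.zero_le _) (Λg \ S) hng (by exact hvg) 𝓑 ?_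
  · change (∑ F₂ ∈ 𝓑, tw θ F₂) * gS[θ, Eg \ (∅ ∪ D), ∅] ≤ gS[θ, Eg \ ∅, ∅] * gS[θ, Eg \ (∅ ∪ D), {some v} ∆ {none}] at key
    rw [empty_union, sdiff_empty] at key
    have h0 := ghteSum_empty_pos (Λ := Λ) hθ (Eg \ D)
    rw [corrIn_eq_ghteSum_div θ S (singleton_subset_iff.2 hv), ← hD, starSet_singleton, mul_div_assoc']
    rw [le_div_iff₀ h0]
    exact key
  · intro F hF
    obtain ⟨hFE, hodd, havoid⟩ := h𝓑 F hF
    refine ⟨?_, hodd, ?_, fun m _ => ?_⟩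
    · show F ⊆ Eg \ ∅
      rw [sdiff_empty]; exact hFE
    · show (ewRun Eg rk (∅ ∪ F) {none} (some v)).pos = none
      rw [empty_union]; exact ewRun_pos_eq_none rk hrk hFE hodd
    · show (ewIter Eg rk (∅ ∪ F) {none} (ewInit (some v)) m).pos ∉ Λg \ S
      rw [empty_union]; exact havoid m

/-- **The exit structure of a backbone that visits the cluster.** Let `F ⊆ ℰ⁺_Λ` have odd vertices
`{v, g}`, let `C ∌ g`, and let `n` be the last time (up to the horizon) at which the walk from `v`
sits in `C`. Then at time `n` the walk is unhalted, not at the ghost, has an available pair (so it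
traverses one), `n` is before the horizon, and the walk never returns to `C`. [cite: AizenmanFernandezJSP1986, §5.1, proof of Lemma 5.5, the decomposition (5.16)–(5.17)] -/
theorem exit_spec (hrk : Set.InjOn rk ↑(Eg)) {F : Finset (Sym2 (Option V))} (hF : F ⊆ Eg) {v : V}
    (hodd : oddVerts Λg F = ({some v} ∆ {none} : Finset (Option V))) {C : Finset (Option V)} (hC : (none : Option V) ∉ C)
    {n : ℕ} (hn : (ewIter Eg rk F {none} (ewInit (some v)) n).pos ∈ C)
    (hmax : ∀ m, n < m → m ≤ (Eg).card + 1 → (ewIter Eg rk F {none} (ewInit (some v)) m).pos ∉ C) :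
    (ewIter Eg rk F {none} (ewInit (some v)) n).halt = false ∧
    (ewIter Eg rk F {none} (ewInit (some v)) n).pos ∉ ({none} : Finset (Option V)) ∧
    (ewAvail Eg F (ewIter Eg rk F {none} (ewInit (some v)) n)).Nonempty ∧
    n < (Eg).card + 1 ∧
    ∀ m, n < m → (ewIter Eg rk F {none} (ewInit (some v)) m).pos ∉ C := by
  set N := (Eg).card + 1 with hN
  set σ := ewIter Eg rk F {none} (ewInit (some v)) n with hσ
  have hfin : (ewRun Eg rk F {none} (some v)).pos = none := ewRun_pos_eq_none rk hrk hF hodd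
  have hnN : n < N := by
    by_contra h
    rw [not_lt] at h
    have := ewIter_eq_ewRun_of_le hrk F {none} (some v) h
    rw [← hσ] at this
    rw [this, hfin] at hn
    exact hC hn
  have hhalt : σ.halt = false := by
    by_contra h
    rw [Bool.not_eq_false] at h
    have h1 := ewIter_eq_of_halt (E := Eg) (rk := rk) (F := F) (T := {none}) (σ₀ := ewInit (some v)) (m := n) h hnN.le
    rw [← ewRun, ← hσ] at h1
    rw [← h1, hfin] at hn
    · exact hC hn
  have hT : σ.pos ∉ ({none} : Finset (Option V)) := fun h => hC (mem_singleton.1 h ▸ hn)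
  have hA : (ewAvail Eg F σ).Nonempty := by
    by_contra hA
    have hs := ewStep_of_empty (E := Eg) (rk := rk) (F := F) (T := {none}) hhalt hT hA
    have h1 : ewIter Eg rk F {none} (ewInit (some v)) (n + 1) = ewStuck Eg σ := by rw [ewIter_succ, ← hσ, hs]
    have h2 : (ewIter Eg rk F {none} (ewInit (some v)) (n + 1)).halt = true := by rw [h1]; rfl
    have h3 := ewIter_eq_of_halt h2 (Nat.succ_le_of_lt hnN)
    rw [← ewRun] at h3
    have : (ewRun Eg rk F {none} (some v)).pos = σ.pos := by rw [h3, h1]; rfl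
    rw [hfin] at this
    exact hC (this ▸ hn)
  refine ⟨hhalt, hT, hA, hnN, fun m hm => ?_⟩
  by_cases hmN : m ≤ N
  · exact hmax m hm hmN
  · rw [not_le] at hmN
    rw [ewIter_eq_ewRun_of_le hrk F {none} (some v) hmN.le, hfin]
    exact hC

/-- **Classes (P2)–(P3), the continuation after the exit**: fix a backbone `F₀` (odd vertices
`{v,g}`) whose last visit to the cluster `C = (Λ ∪ {g}) ∖ S` is at time `n₀`, and let `δ⁺` be its
state at time `n₀ + 1` (just after the exit step). The backbones sharing that state at that time and
not returning to `C` weigh at most `tw(δ⁺.trav) · g_{ℰ⁺∖δ⁺.used}(∅) · c`, with `c = ⟨σ_l⟩_S` if the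
exit step went to the lattice site `l` and `c = 1` if it went to the ghost (the avoidance bound for
the continuation, then Griffiths II `⟨σ_l⟩_{(U∪D)ᶜ} ≤ ⟨σ_l⟩_S`). [cite: AizenmanFernandezJSP1986, §5.1, proof of Lemma 5.5, eqs. (5.17)–(5.18)] -/
theorem sum_tw_exitFiber_le {θ : Sym2 (Option V) → ℝ} (hθ : ∀ e, 0 ≤ θ e) (hrk : Set.InjOn rk ↑(Eg))
    {S : Finset (Option V)} (hg : (none : Option V) ∈ S) {v : V} (hv : v ∈ Λ)
    {F₀ : Finset (Sym2 (Option V))} (hF₀ : F₀ ⊆ Eg) (hodd₀ : oddVerts Λg F₀ = ({some v} ∆ {none} : Finset (Option V)))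
    {n₀ : ℕ} (hn₀ : (ewIter Eg rk F₀ {none} (ewInit (some v)) n₀).pos ∈ Λg \ S)
    (hmax₀ : ∀ m, n₀ < m → m ≤ (Eg).card + 1 → (ewIter Eg rk F₀ {none} (ewInit (some v)) m).pos ∉ Λg \ S)
    (𝓑 : Finset (Finset (Sym2 (Option V))))
    (h𝓑 : ∀ F ∈ 𝓑, F ⊆ Eg ∧ oddVerts Λg F = ({some v} ∆ {none} : Finset (Option V)) ∧
      ewIter Eg rk F {none} (ewInit (some v)) (n₀ + 1) = ewIter Eg rk F₀ {none} (ewInit (some v)) (n₀ + 1) ∧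
      ∀ m, n₀ < m → (ewIter Eg rk F {none} (ewInit (some v)) m).pos ∉ Λg \ S) :
    ∑ F ∈ 𝓑, tw θ F ≤
      tw θ (ewIter Eg rk F₀ {none} (ewInit (some v)) (n₀ + 1)).trav *
        gS[θ, Eg \ (ewIter Eg rk F₀ {none} (ewInit (some v)) (n₀ + 1)).used, ∅] *
        Option.elim (ewIter Eg rk F₀ {none} (ewInit (some v)) (n₀ + 1)).pos 1 (fun l => corrIn G Λ θ S {l}) := by
  classical
  have hvg : (some v : Option V) ∈ Λg := Finset.some_mem_insertNone.2 hv
  have hng : (none : Option V) ∈ Λg := Finset.none_mem_insertNone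
  have hC : (none : Option V) ∉ Λg \ S := fun h => (mem_sdiff.1 h).2 hg
  obtain ⟨-, -, -, hnN, -⟩ := exit_spec rk hrk hF₀ hodd₀ hC hn₀ hmax₀
  set δ := ewIter Eg rk F₀ {none} (ewInit (some v)) (n₀ + 1) with hδ
  set U₁ := δ.used with hU₁
  set P₁ := δ.trav with hP₁
  set D := edgesMeeting (G := G) (Λ := Λ) (Λg \ S) with hD
  have hI : EWInv Eg F₀ δ := ewInv_iter hrk {none} (ewInv_init (E := Eg) F₀ (some v)) (n₀ + 1)
  have hPU : P₁ ⊆ U₁ := hI.2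
  have hUE : U₁ ⊆ Eg := hI.3
  have hpos : δ.pos ∈ Λg := ewIter_pos_mem rk F₀ {none} hvg (n₀ + 1)
  have hoddP : oddVerts Λg P₁ = {some v} ∆ {δ.pos} := oddVerts_trav_eq rk hrk F₀ {none} hvg (n₀ + 1) hpos
  -- the fibre: `F ∩ U₁ = P₁`
  have hfib : ∀ F ∈ 𝓑, F ∩ U₁ = P₁ := by
    intro F hF
    obtain ⟨-, -, hW, -⟩ := h𝓑 F hF
    have := inter_used_eq_trav hrk {none} (ewInv_init (E := Eg) F (some v)) (n₀ + 1)
    rw [hW] at this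
    exact this
  have hdec : ∀ F ∈ 𝓑, P₁ ∪ F \ U₁ = F := fun F hF => by rw [← hfib F hF]; exact sup_inf_sdiff F U₁
  -- `∑_𝓑 tw F = tw P₁ · ∑_{𝓕} tw F₂`, `𝓕 = {F ∖ U₁}`
  set 𝓕 := 𝓑.image (fun F => F \ U₁) with h𝓕
  have hinj : Set.InjOn (fun F : Finset (Sym2 (Option V)) => F \ U₁) ↑𝓑 := by
    intro F hF F' hF' heq
    simp only at heq
    rw [← hdec F hF, ← hdec F' hF', heq]
  have hsum : ∑ F ∈ 𝓑, tw θ F = tw θ P₁ * ∑ F₂ ∈ 𝓕, tw θ F₂ := by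
    rw [h𝓕, sum_image hinj, mul_sum]
    refine sum_congr rfl fun F hF => ?_
    conv_lhs => rw [← hdec F hF]
    exact tw_union (Finset.disjoint_left.2 fun e heP heF => (mem_sdiff.1 heF).2 (hPU heP))
  -- the avoidance bound for the continuation from `δ`
  have key := sum_tw_avoid_le rk hθ hrk F₀ {none} hvg (Nat.succ_le_of_lt hnN) (Λg \ S) hng hpos 𝓕 ?_
  · rw [← hδ] at key
    change (∑ F₂ ∈ 𝓕, tw θ F₂) * gS[θ, Eg \ (U₁ ∪ D), ∅] ≤ gS[θ, Eg \ U₁, ∅] * gS[θ, Eg \ (U₁ ∪ D), {δ.pos} ∆ {none}] at key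
    have hD0 := ghteSum_empty_pos (Λ := Λ) hθ (Eg \ (U₁ ∪ D))
    have htw := tw_nonneg hθ P₁
    have hgU : 0 ≤ gS[θ, Eg \ U₁, ∅] := ghteSum_nonneg hθ _ _
    rw [hsum]
    -- according to where the exit step went
    rcases hw : δ.pos with _ | l
    · -- to the ghost: `{g} ∆ {g} = ∅`, the bound is `g_{ℰ⁺∖U₁}(∅)`
      rw [hw, symmDiff_self] at key
      change (∑ F₂ ∈ 𝓕, tw θ F₂) * gS[θ, Eg \ (U₁ ∪ D), ∅] ≤ gS[θ, Eg \ U₁, ∅] * gS[θ, Eg \ (U₁ ∪ D), ∅] at key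
      simp only [Option.elim, mul_one]
      refine mul_le_mul_of_nonneg_left ?_ htw
      exact le_of_mul_le_mul_right key hD0
    · -- to the lattice site `l`: Griffiths II `⟨σ_l⟩_{(U₁∪D)ᶜ} ≤ ⟨σ_l⟩_S`
      rw [hw] at key hpos
      have hl : l ∈ Λ := Finset.some_mem_insertNone.1 hpos
      simp only [Option.elim]
      rw [mul_assoc]
      refine mul_le_mul_of_nonneg_left ?_ htw
      have h2 := ghteSum_div_le_corrIn (G := G) (Λ := Λ) hθ S hUE (singleton_subset_iff.2 hl) (θ := θ)
      rw [starSet_singleton, ← hD, div_le_iff₀ hD0] at h2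
      refine le_of_mul_le_mul_right ?_ hD0
      calc (∑ F₂ ∈ 𝓕, tw θ F₂) * gS[θ, Eg \ (U₁ ∪ D), ∅]
          ≤ gS[θ, Eg \ U₁, ∅] * gS[θ, Eg \ (U₁ ∪ D), {some l} ∆ {none}] := key
        _ ≤ gS[θ, Eg \ U₁, ∅] * (corrIn G Λ θ S {l} * gS[θ, Eg \ (U₁ ∪ D), ∅]) :=
            mul_le_mul_of_nonneg_left h2 hgU
        _ = gS[θ, Eg \ U₁, ∅] * corrIn G Λ θ S {l} * gS[θ, Eg \ (U₁ ∪ D), ∅] := by ring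
  · -- membership conditions for `𝓕`
    intro F₂ hF₂
    obtain ⟨F, hF, rfl⟩ := mem_image.1 hF₂
    obtain ⟨hFE, hodd, hW, havoid⟩ := h𝓑 F hF
    rw [← hδ]
    change F \ U₁ ⊆ Eg \ U₁ ∧ oddVerts Λg (F \ U₁) = {δ.pos} ∆ {none} ∧
      (ewRun Eg rk (P₁ ∪ F \ U₁) {none} (some v)).pos = none ∧
      ∀ m, n₀ + 1 ≤ m → (ewIter Eg rk (P₁ ∪ F \ U₁) {none} (ewInit (some v)) m).pos ∉ Λg \ S
    rw [hdec F hF]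
    refine ⟨sdiff_subset_sdiff hFE subset_rfl, ?_, ewRun_pos_eq_none rk hrk hFE hodd, fun m hm => havoid m hm⟩
    have hdisj : Disjoint P₁ (F \ U₁) := Finset.disjoint_left.2 fun e heP heF => (mem_sdiff.1 heF).2 (hPU heP)
    have h1 := oddVerts_union_of_disjoint Λg hdisj
    rw [hdec F hF, hodd, hoddP] at h1
    have : oddVerts Λg (F \ U₁) = ({some v} ∆ {δ.pos}) ∆ ({some v} ∆ {none}) := by
      rw [h1, symmDiff_symmDiff_cancel_left]
    rw [this, symmDiff_comm ({some v} : Finset (Option V)) {δ.pos}, symmDiff_assoc, symmDiff_symmDiff_cancel_left]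

/-- **Classes (P2)–(P3), the walk up to the exit: surgery.** Fix `k ∈ C` and the far end `w` of
the exit step (`w = g` or a lattice neighbour of `k`), and a set `X` of exit signatures
`(δ⁻, δ⁺)` (the states just before and after the exit step `e = {k, w}`) realised by backbones from
`v`. Then `∑_{x ∈ X} tw(δ⁺.trav) g_{ℰ⁺∖δ⁺.used}(∅) ≤ tanh θ_e · K(v,k) · g(∅)`: removing the exit step
from `δ⁺.trav ∪ F''` (`F''` sourceless off `δ⁺.used`) gives, injectively, an edge set with odd
vertices `{v, k}` whose backbone towards `{k, g}` ends at `k` (Prop. 4.6, eq. (4.21): "splitting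
from the paths their last step"). [cite: AizenmanFernandezJSP1986, §4.3, Prop. 4.6, eq. (4.21); §5.1, eq. (5.17)] -/
theorem sum_exitPairs_le {θ : Sym2 (Option V) → ℝ} (hθ : ∀ e, 0 ≤ θ e) (hrk : Set.InjOn rk ↑(Eg)) {v : V} (hv : v ∈ Λ)
    {k : V} {w : Option V} (X : Finset (EWState (Option V) × EWState (Option V)))
    (hX : ∀ x ∈ X, ∃ F₀ : Finset (Sym2 (Option V)), F₀ ⊆ Eg ∧ ∃ n₀ : ℕ,
      ewIter Eg rk F₀ {none} (ewInit (some v)) n₀ = x.1 ∧ ewIter Eg rk F₀ {none} (ewInit (some v)) (n₀ + 1) = x.2 ∧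
      x.1.halt = false ∧ (ewAvail Eg F₀ x.1).Nonempty ∧ x.1.pos = some k ∧ x.2.pos = w) :
    ∑ x ∈ X, tw θ x.2.trav * gS[θ, Eg \ x.2.used, ∅] ≤
      Real.tanh (θ s(some k, w)) * (bbKernel G Λ rk θ v k * gS[θ, Eg, ∅]) := by
  classical
  have hvg : (some v : Option V) ∈ Λg := Finset.some_mem_insertNone.2 hv
  set e : Sym2 (Option V) := s(some k, w) with he
  set T : Finset (Option V) := {none} with hT
  -- per-signature facts
  have hx : ∀ x ∈ X, x.1.trav ⊆ x.1.used ∧ x.1.used ⊆ x.2.used ∧ x.2.trav ⊆ x.2.used ∧ x.2.used ⊆ Eg ∧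
      x.2.trav = insert e x.1.trav ∧ e ∉ x.1.trav ∧ oddVerts Λg x.1.trav = {some v} ∆ {some k} ∧
      ∀ Y : Finset (Sym2 (Option V)), Y ⊆ Eg \ x.2.used →
        (∃ n, ewIter Eg rk (insert e (x.1.trav ∪ Y)) T (ewInit (some v)) n = x.1 ∧
          ewIter Eg rk (insert e (x.1.trav ∪ Y)) T (ewInit (some v)) (n + 1) = x.2) ∧
        (ewRun Eg rk (x.1.trav ∪ Y) {some k, none} (some v)).pos = some k := by
    intro x hxX
    obtain ⟨F₀, hF₀, n₀, hW1, hW2, hh, hA, hpk, hpw⟩ := hX x hxX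
    have hT1 : x.1.pos ∉ T := by rw [hpk, hT]; simp
    have hh' : (ewIter Eg rk F₀ T (ewInit (some v)) n₀).halt = false := by rw [hW1]; exact hh
    have hT1' : (ewIter Eg rk F₀ T (ewInit (some v)) n₀).pos ∉ T := by rw [hW1]; exact hT1
    have hA' : (ewAvail Eg F₀ (ewIter Eg rk F₀ T (ewInit (some v)) n₀)).Nonempty := by rw [hW1]; exact hA
    obtain ⟨hstep, haE, hpa, haU, -, -⟩ := ewStep_traverse_spec (E := Eg) (rk := rk) hh' hT1' hA'
    set a := Function.argminOn rk (↑(ewAvail Eg F₀ (ewIter Eg rk F₀ T (ewInit (some v)) n₀)) : Set (Sym2 (Option V))) hA'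
      with ha
    rw [hW1] at hstep hpa haU
    have hx2 : x.2 = ewAdvance Eg rk x.1 a := by rw [← hW2, ewIter_succ, hW1, hstep]
    -- the traversed pair is `e = {k, w}`
    have hae : a = e := by
      have h1 : x.2.pos = edgeOther x.1.pos a := by rw [hx2]; rfl
      rw [hpw, hpk] at h1
      rw [he, h1, ← hpk]
      exact (mk_edgeOther_eq hpa).symm
    have hI1 : EWInv Eg F₀ x.1 := hW1 ▸ ewInv_iter hrk T (ewInv_init (E := Eg) F₀ (some v)) n₀
    have hI2 : EWInv Eg F₀ x.2 := hW2 ▸ ewInv_iter hrk T (ewInv_init (E := Eg) F₀ (some v)) (n₀ + 1)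
    have hU12 : x.1.used ⊆ x.2.used := by
      rw [← hW1, ← hW2]; exact used_mono_ewIter F₀ T (ewInit (some v)) (Nat.le_succ n₀)
    have htrav2 : x.2.trav = insert e x.1.trav := by rw [hx2, ← hae]; rfl
    have heT : e ∉ x.1.trav := fun h => haU (hae ▸ hI1.2 h)
    have hkΛ : (some k : Option V) ∈ Λg := by
      have := (mem_edgesIn_iff.1 haE).2 _ hpa
      rwa [hpk] at this
    have hodd1 : oddVerts Λg x.1.trav = {some v} ∆ {some k} := by
      have := oddVerts_trav_eq rk hrk F₀ T hvg n₀ (by rw [hW1, hpk]; exact hkΛ)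
      rwa [hW1, hpk] at this
    refine ⟨hI1.2, hU12, hI2.2, hI2.3, htrav2, heT, hodd1, fun Y hY => ?_⟩
    set X' := insert e (x.1.trav ∪ Y) with hX'
    have hint2 : F₀ ∩ x.2.used = x.2.trav := by
      have := inter_used_eq_trav hrk T (ewInv_init (E := Eg) F₀ (some v)) (n₀ + 1)
      rwa [hW2] at this
    have hX'int : X' ∩ x.2.used = x.2.trav := by
      rw [htrav2, hX']
      ext f
      simp only [mem_inter, mem_insert, mem_union]
      constructor
      · rintro ⟨rfl | hf | hf, hfU⟩
        · exact Or.inl rfl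
        · exact Or.inr hf
        · exact absurd hfU (mem_sdiff.1 (hY hf)).2
      · rintro (rfl | hf)
        · refine ⟨Or.inl rfl, hI2.2 ?_⟩
          rw [htrav2]; exact mem_insert_self _ _
        · exact ⟨Or.inr (Or.inl hf), hU12 (hI1.2 hf)⟩
    -- the two walks agree up to time `n₀ + 1`
    have hagree : ∀ m ≤ n₀ + 1, ewIter Eg rk X' T (ewInit (some v)) m = ewIter Eg rk F₀ T (ewInit (some v)) m := by
      refine ewIter_congr hrk fun f hf => ?_
      rw [hW2] at hf
      constructor
      · intro hfF
        have : f ∈ F₀ ∩ x.2.used := mem_inter.2 ⟨hfF, hf⟩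
        rw [hint2, ← hX'int] at this
        exact (mem_inter.1 this).1
      · intro hfX
        have : f ∈ X' ∩ x.2.used := mem_inter.2 ⟨hfX, hf⟩
        rw [hX'int, ← hint2] at this
        exact (mem_inter.1 this).1
    have hX1 : ewIter Eg rk X' T (ewInit (some v)) n₀ = x.1 := by rw [hagree n₀ (Nat.le_succ _), hW1]
    have hX2 : ewIter Eg rk X' T (ewInit (some v)) (n₀ + 1) = x.2 := by rw [hagree (n₀ + 1) le_rfl, hW2]
    refine ⟨⟨n₀, hX1, hX2⟩, ?_⟩
    -- surgery on `X'` at time `n₀`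
    have hhX : (ewIter Eg rk X' T (ewInit (some v)) n₀).halt = false := by rw [hX1]; exact hh
    have hTX : (ewIter Eg rk X' T (ewInit (some v)) n₀).pos ∉ T := by rw [hX1]; exact hT1
    have hAX : (ewAvail Eg X' (ewIter Eg rk X' T (ewInit (some v)) n₀)).Nonempty := by
      by_contra hcon
      have h1 := ewStep_of_empty (E := Eg) (rk := rk) (F := X') (T := T) hhX hTX hcon
      have h2 : ewIter Eg rk X' T (ewInit (some v)) (n₀ + 1) = ewStuck Eg x.1 := by rw [ewIter_succ, h1, hX1]
      rw [hX2, hx2] at h2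
      have := congrArg EWState.halt h2
      exact Bool.false_ne_true this
    set a' := Function.argminOn rk (↑(ewAvail Eg X' (ewIter Eg rk X' T (ewInit (some v)) n₀)) : Set (Sym2 (Option V))) hAX
      with ha'
    have ha'e : a' = e := by
      have h1 := ewStep_of_nonempty (E := Eg) (rk := rk) (F := X') (T := T) hhX hTX hAX
      rw [← ha'] at h1
      have h2 : ewIter Eg rk X' T (ewInit (some v)) (n₀ + 1) = ewAdvance Eg rk x.1 a' := by rw [ewIter_succ, h1, hX1]
      rw [hX2, hx2, hae] at h2
      have h3 := congrArg EWState.trav h2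
      change insert e x.1.trav = insert a' x.1.trav at h3
      have h4 : a' ∈ insert e x.1.trav := by rw [h3]; exact mem_insert_self _ _
      rcases mem_insert.1 h4 with h5 | h5
      · exact h5
      · exfalso
        have ha'A := argminOn_mem_ewAvail (E := Eg) (rk := rk) hAX
        rw [← ha', hX1, mem_ewAvail] at ha'A
        exact ha'A.1.2.2 (hI1.2 h5)
    have hsurg := ewRun_erase_pos_eq hrk (F := X') (T := T) (v := some v) (a := some k) (i := n₀) hhX
      (by rw [hX1]; exact hpk) (by rw [hT]; simp) hAX
    rw [← ha', ha'e] at hsurg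
    have heY : e ∉ x.1.trav ∪ Y := by
      rw [mem_union, not_or]
      refine ⟨heT, fun h => (mem_sdiff.1 (hY h)).2 (hI2.2 ?_)⟩
      rw [htrav2]; exact mem_insert_self _ _
    rw [hX', erase_insert heY] at hsurg
    exact hsurg
  -- the weights: `tw(δ⁺.trav) g_{ℰ⁺∖δ⁺.used}(∅) = tanh θ_e ∑_{Y} tw(δ⁻.trav ∪ Y)`
  set S : EWState (Option V) × EWState (Option V) → Finset (Finset (Sym2 (Option V))) :=
    fun x => (Eg \ x.2.used).powerset.filter (fun Y => oddVerts Λg Y = ∅) with hS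
  set Ψ : (Σ _ : EWState (Option V) × EWState (Option V), Finset (Sym2 (Option V))) → Finset (Sym2 (Option V)) :=
    fun y => y.1.1.trav ∪ y.2 with hΨ
  have hmemS : ∀ y ∈ X.sigma S, y.1 ∈ X ∧ y.2 ⊆ Eg \ y.1.2.used ∧ oddVerts Λg y.2 = ∅ := by
    intro y hy
    rw [mem_sigma] at hy
    obtain ⟨h1, h2⟩ := hy
    rw [mem_filter, mem_powerset] at h2
    exact ⟨h1, h2.1, h2.2⟩
  have hdisj : ∀ y ∈ X.sigma S, Disjoint y.1.1.trav y.2 := by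
    intro y hy
    obtain ⟨h1, h2, -⟩ := hmemS y hy
    obtain ⟨ht1, hu12, -, -, -, -, -, -⟩ := hx y.1 h1
    exact Finset.disjoint_left.2 fun f hf hf2 => (mem_sdiff.1 (h2 hf2)).2 (hu12 (ht1 hf))
  have hL : ∑ x ∈ X, tw θ x.2.trav * gS[θ, Eg \ x.2.used, ∅] = Real.tanh (θ e) * ∑ y ∈ X.sigma S, tw θ (Ψ y) := by
    rw [mul_sum, sum_sigma]
    refine sum_congr rfl fun x hxX => ?_
    obtain ⟨-, -, -, -, htrav2, heT, -, -⟩ := hx x hxX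
    rw [ghteSum_eq_sum_tw, mul_sum]
    refine sum_congr rfl fun Y hY => ?_
    have hy : (⟨x, Y⟩ : Σ _ : EWState (Option V) × EWState (Option V), Finset (Sym2 (Option V))) ∈ X.sigma S :=
      mem_sigma.2 ⟨hxX, hY⟩
    rw [hΨ]
    simp only
    rw [tw_union (hdisj _ hy), htrav2, tw_insert heT, mul_assoc]
  -- `Ψ` is injective: the exit step is traversed exactly once
  have hinj : Set.InjOn Ψ ↑(X.sigma S) := by
    intro y hy y' hy' hyy
    obtain ⟨hy1, hy2, -⟩ := hmemS y hy
    obtain ⟨hy'1, hy'2, -⟩ := hmemS y' hy'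
    obtain ⟨ht1, hu12, ht2, -, htrav2, heT, -, hGL⟩ := hx y.1 hy1
    obtain ⟨ht1', hu12', ht2', -, htrav2', heT', -, hGL'⟩ := hx y'.1 hy'1
    obtain ⟨⟨n, hn1, hn2⟩, -⟩ := hGL y.2 hy2
    obtain ⟨⟨n', hn1', hn2'⟩, -⟩ := hGL' y'.2 hy'2
    have hΨeq : Ψ y = Ψ y' := hyy
    simp only [hΨ] at hΨeq
    rw [hΨeq] at hn1 hn2
    set Z := insert e (y'.1.1.trav ∪ y'.2) with hZ
    -- the times agree
    have hnn : n = n' := by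
      by_contra hne
      rcases Nat.lt_or_gt_of_ne hne with hlt | hlt
      · have hsub := trav_mono_ewIter (E := Eg) (rk := rk) Z T (ewInit (some v)) (Nat.succ_le_of_lt hlt)
        rw [hn2, hn1'] at hsub
        refine heT' (hsub ?_)
        rw [htrav2]; exact mem_insert_self _ _
      · have hsub := trav_mono_ewIter (E := Eg) (rk := rk) Z T (ewInit (some v)) (Nat.succ_le_of_lt hlt)
        rw [hn2', hn1] at hsub
        refine heT (hsub ?_)
        rw [htrav2']; exact mem_insert_self _ _
    subst hnn
    have h11 : y.1.1 = y'.1.1 := hn1.symm.trans hn1'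
    have h12 : y.1.2 = y'.1.2 := hn2.symm.trans hn2'
    have h1 : y.1 = y'.1 := Prod.ext h11 h12
    have h2 : y.2 = y'.2 := by
      have hd := hdisj y hy
      have hd' := hdisj y' hy'
      have e1 : y.2 = (y.1.1.trav ∪ y.2) \ y.1.1.trav := by
        rw [union_sdiff_left, eq_comm, Finset.sdiff_eq_self_iff_disjoint]; exact hd.symm
      have e2 : y'.2 = (y'.1.1.trav ∪ y'.2) \ y'.1.1.trav := by
        rw [union_sdiff_left, eq_comm, Finset.sdiff_eq_self_iff_disjoint]; exact hd'.symm
      rw [e1, e2, hΨeq, h11]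
    exact Sigma.ext h1 (heq_of_eq h2)
  -- the image lies in the family defining `K(v,k)`
  have hKg : bbKernel G Λ rk θ v k * gS[θ, Eg, ∅] =
      ∑ F ∈ (Eg).powerset with (oddVerts Λg F = ({some v} ∆ {some k} : Finset (Option V)) ∧
        (ewRun Eg rk F {some k, none} (some v)).pos = some k), tw θ F := by
    rw [bbKernel, div_mul_cancel₀ _ (ghteSum_empty_pos hθ _).ne']
  rw [hL, hKg, ← sum_image hinj]
  refine mul_le_mul_of_nonneg_left ?_ (Literature.Probability.LatticeModels.tanh_nonneg (hθ e))
  refine sum_le_sum_of_subset_of_nonneg (fun Z hZ => ?_) fun F _ _ => tw_nonneg hθ F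
  obtain ⟨y, hy, rfl⟩ := mem_image.1 hZ
  obtain ⟨hy1, hy2, hy3⟩ := hmemS y (mem_coe.1 hy)
  obtain ⟨ht1, hu12, -, hUE, -, -, hodd1, hGL⟩ := hx y.1 hy1
  obtain ⟨-, hK⟩ := hGL y.2 hy2
  rw [mem_filter, mem_powerset, hΨ]
  simp only
  refine ⟨union_subset ((ht1.trans hu12).trans hUE) (hy2.trans sdiff_subset), ?_, hK⟩
  rw [oddVerts_union_of_disjoint Λg (hdisj y (mem_coe.1 hy)), hodd1, hy3]
  exact symmDiff_bot _

/-! ### Lemma 5.5 -/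

/-- **Aizenman–Fernández 1986, Lemma 5.5, eq. (5.15)** (the effect on the magnetisation of removing
the bonds at a cluster), for the `θ`-system on `Λ ∪ {g}` and a retained region `S ∋ g`
(`C = (Λ ∪ {g}) ∖ S` the removed cluster, `⟨·⟩_S = corrIn θ S` the system with every bond meeting `C`
switched off, `K = bbKernel` the backbone kernel):
`⟨σ_v⟩ - ⟨σ_v⟩_S ≤ ∑_{k ∈ Λ, k ∈ C} K(v,k) · (tanh θ_{kg} + ∑_{l ∈ Λ, l ∼ k} tanh θ_{kl} ⟨σ_l⟩_S)`.
As printed, (5.15) reads `⟨σ_v⟩ - ⟨σ_v⟩_{Aᶜ} ≤ ∑_{k ∈ H(A_h)} tanh(βh) K(v,k) + ∑_{(k,l)} K(v,k)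
tanh(βJ_{kl}) ⟨σ_l⟩_{Aᶜ}` for a deterministic bond set `A = A_h ∪ A_L`; here `A` is the set of all
bonds meeting `C` (the case used in Theorems 5.6–5.7), the field bonds `A_h = {{k,g} : k ∈ C}` and
the lattice bonds `A_L ⊇ {{k,l} : k ∈ C}` (terms with `l ∈ C` vanish since then `⟨σ_l⟩_S = 0`, and
are kept as harmless nonnegative terms). [cite: AizenmanFernandezJSP1986, §5.1, Lemma 5.5, eq. (5.15)] -/
theorem thetaCorr_singleton_sub_corrIn_le [DecidableRel G.Adj] {θ : Sym2 (Option V) → ℝ} (hθ : ∀ e, 0 ≤ θ e)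
    (hrk : Set.InjOn rk ↑(Eg)) {S : Finset (Option V)} (hg : (none : Option V) ∈ S) {v : V} (hv : v ∈ Λ) :
    thetaCorr G Λ θ {v} - corrIn G Λ θ S {v} ≤
      ∑ k ∈ Λ with (some k ∉ S), bbKernel G Λ rk θ v k *
        (Real.tanh (θ (ghostEdge k)) +
          ∑ l ∈ Λ with G.Adj k l, Real.tanh (θ (liftEdge s(k, l))) * corrIn G Λ θ S {l}) := by
  classical
  have hvg : (some v : Option V) ∈ Λg := Finset.some_mem_insertNone.2 hv
  set N := (Eg).card + 1 with hN
  set C : Finset (Option V) := Λg \ S with hCdef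
  have hC : (none : Option V) ∉ C := fun h => (mem_sdiff.1 h).2 hg
  set B₀ : Finset (Option V) := {some v} ∆ {none} with hB₀
  set 𝓐 := (Eg).powerset.filter (fun F => oddVerts Λg F = B₀) with h𝓐
  have hg0 := ghteSum_empty_pos (Λ := Λ) hθ (Eg)
  -- `⟨σ_v⟩ g(∅) = ∑_𝓐 tw`
  have hlhs : thetaCorr G Λ θ {v} * gS[θ, Eg, ∅] = ∑ F ∈ 𝓐, tw θ F := by
    rw [thetaCorr_eq_ghteSum_div θ (singleton_subset_iff.2 hv), starSet_singleton, div_mul_cancel₀ _ hg0.ne',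
      ghteSum_eq_sum_tw]
  -- the visit times and the split
  set vis : Finset (Sym2 (Option V)) → Finset ℕ :=
    fun F => (range (N + 1)).filter (fun m => (ewIter Eg rk F {none} (ewInit (some v)) m).pos ∈ C) with hvis
  have hmem𝓐 : ∀ F ∈ 𝓐, F ⊆ Eg ∧ oddVerts Λg F = B₀ := fun F hF => by
    rw [h𝓐, mem_filter, mem_powerset] at hF; exact hF
  have hsplit := (sum_filter_add_sum_filter_not 𝓐 (fun F => vis F = ∅) (tw θ)).symm
  -- (P1): no visit to `C`
  have hP1 : ∑ F ∈ 𝓐.filter (fun F => vis F = ∅), tw θ F ≤ gS[θ, Eg, ∅] * corrIn G Λ θ S {v} := by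
    refine sum_tw_noVisit_le rk hθ hrk S hv _ fun F hF => ?_
    rw [mem_filter] at hF
    obtain ⟨hFE, hodd⟩ := hmem𝓐 F hF.1
    refine ⟨hFE, hodd, fun m hm => ?_⟩
    by_cases hmN : m ≤ N
    · have : m ∈ vis F := by
        rw [hvis]; exact mem_filter.2 ⟨mem_range.2 (Nat.lt_succ_of_le hmN), hm⟩
      rw [hF.2] at this
      exact notMem_empty m this
    · rw [not_le] at hmN
      rw [ewIter_eq_ewRun_of_le hrk F {none} (some v) hmN.le, ewRun_pos_eq_none rk hrk hFE hodd] at hm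
      exact hC hm
  -- (P2)–(P3): the last visit and the exit signature
  set nst : Finset (Sym2 (Option V)) → ℕ := fun F => if h : (vis F).Nonempty then (vis F).max' h else 0 with hnst
  set xs : Finset (Sym2 (Option V)) → EWState (Option V) × EWState (Option V) :=
    fun F => (ewIter Eg rk F {none} (ewInit (some v)) (nst F), ewIter Eg rk F {none} (ewInit (some v)) (nst F + 1)) with hxs
  set 𝓐₂ := 𝓐.filter (fun F => ¬vis F = ∅) with h𝓐₂
  have hfacts : ∀ F ∈ 𝓐₂, F ⊆ Eg ∧ oddVerts Λg F = B₀ ∧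
      (ewIter Eg rk F {none} (ewInit (some v)) (nst F)).pos ∈ C ∧
      (∀ m, nst F < m → m ≤ N → (ewIter Eg rk F {none} (ewInit (some v)) m).pos ∉ C) ∧
      (ewIter Eg rk F {none} (ewInit (some v)) (nst F)).halt = false ∧
      (ewAvail Eg F (ewIter Eg rk F {none} (ewInit (some v)) (nst F))).Nonempty ∧
      nst F < N ∧ ∀ m, nst F < m → (ewIter Eg rk F {none} (ewInit (some v)) m).pos ∉ C := by
    intro F hF
    rw [h𝓐₂, mem_filter] at hF
    obtain ⟨hFE, hodd⟩ := hmem𝓐 F hF.1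
    have hne : (vis F).Nonempty := nonempty_iff_ne_empty.2 hF.2
    have hnstF : nst F = (vis F).max' hne := by rw [hnst]; simp only [hne, dif_pos]
    have hn : (ewIter Eg rk F {none} (ewInit (some v)) (nst F)).pos ∈ C := by
      have := max'_mem (vis F) hne
      rw [← hnstF, hvis, mem_filter] at this
      exact this.2
    have hmax : ∀ m, nst F < m → m ≤ N → (ewIter Eg rk F {none} (ewInit (some v)) m).pos ∉ C := by
      intro m hm hmN hpos
      have hmvis : m ∈ vis F := by rw [hvis]; exact mem_filter.2 ⟨mem_range.2 (Nat.lt_succ_of_le hmN), hpos⟩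
      have := le_max' (vis F) m hmvis
      rw [← hnstF] at this
      omega
    obtain ⟨hh, -, hA, hnN, hafter⟩ := exit_spec rk hrk hFE hodd hC hn hmax
    exact ⟨hFE, hodd, hn, hmax, hh, hA, hnN, hafter⟩
  -- the bound on each fibre of `xs`
  set f : EWState (Option V) × EWState (Option V) → ℝ :=
    fun x => tw θ x.2.trav * gS[θ, Eg \ x.2.used, ∅] * Option.elim x.2.pos 1 (fun l => corrIn G Λ θ S {l}) with hf
  set I := 𝓐₂.image xs with hI
  have hfib : ∀ x ∈ I, ∑ F ∈ 𝓐₂.filter (fun F => xs F = x), tw θ F ≤ f x := by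
    intro x hx
    obtain ⟨F₀, hF₀, hxF₀⟩ := mem_image.1 hx
    obtain ⟨hF₀E, hodd₀, hn₀, hmax₀, hh₀, -, -, -⟩ := hfacts F₀ hF₀
    have hx2 : x.2 = ewIter Eg rk F₀ {none} (ewInit (some v)) (nst F₀ + 1) := by rw [← hxF₀]
    have key := sum_tw_exitFiber_le rk hθ hrk hg hv hF₀E hodd₀ hn₀ hmax₀ (𝓐₂.filter (fun F => xs F = x)) ?_
    · rw [hf]; simp only; rw [hx2]; exact key
    · intro F hF
      rw [mem_filter] at hF
      obtain ⟨hFE, hodd, -, -, hh, -, -, hafter⟩ := hfacts F hF.1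
      -- the exit times agree: `#trav = time` while unhalted
      have heq1 : ewIter Eg rk F {none} (ewInit (some v)) (nst F) = ewIter Eg rk F₀ {none} (ewInit (some v)) (nst F₀) := by
        have h1 := congrArg Prod.fst hF.2
        have h2 := congrArg Prod.fst hxF₀
        simp only [hxs] at h1 h2
        rw [h1, h2]
      have hnn : nst F = nst F₀ := by
        have h1 := card_trav_eq_of_halt_eq_false (E := Eg) (rk := rk) (F := F) (T := {none}) (v := some v) hrk hh
        have h2 := card_trav_eq_of_halt_eq_false (E := Eg) (rk := rk) (F := F₀) (T := {none}) (v := some v) hrk hh₀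
        rw [← h1, ← h2, heq1]
      refine ⟨hFE, hodd, ?_, fun m hm => hafter m (hnn ▸ hm)⟩
      have h1 := congrArg Prod.snd hF.2
      have h2 := congrArg Prod.snd hxF₀
      simp only [hxs] at h1 h2
      rw [← hnn, h1, hnn, h2]
  have hP23a : ∑ F ∈ 𝓐₂, tw θ F ≤ ∑ x ∈ I, f x := by
    rw [← sum_fiberwise_of_maps_to (fun F hF => mem_image_of_mem xs hF) (tw θ)]
    exact sum_le_sum hfib
  -- regroup the signatures by `k = δ⁻.pos` and `w = δ⁺.pos`
  have hsig : ∀ x ∈ I, ∃ k ∈ Λ, some k ∉ S ∧ x.1.pos = some k ∧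
      (x.2.pos = none ∨ ∃ l ∈ Λ, G.Adj k l ∧ x.2.pos = some l) ∧
      ∃ F₀ : Finset (Sym2 (Option V)), F₀ ⊆ Eg ∧ ∃ n₀ : ℕ,
        ewIter Eg rk F₀ {none} (ewInit (some v)) n₀ = x.1 ∧ ewIter Eg rk F₀ {none} (ewInit (some v)) (n₀ + 1) = x.2 ∧
        x.1.halt = false ∧ (ewAvail Eg F₀ x.1).Nonempty := by
    intro x hx
    obtain ⟨F₀, hF₀, hxF₀⟩ := mem_image.1 hx
    obtain ⟨hF₀E, -, hn₀, -, hh₀, hA₀, -, -⟩ := hfacts F₀ hF₀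
    have hx1 : x.1 = ewIter Eg rk F₀ {none} (ewInit (some v)) (nst F₀) := by rw [← hxF₀]
    have hx2 : x.2 = ewIter Eg rk F₀ {none} (ewInit (some v)) (nst F₀ + 1) := by rw [← hxF₀]
    -- `δ⁻.pos ∈ C`, so it is a real vertex `k ∉ S`
    have hposC : x.1.pos ∈ C := by rw [hx1]; exact hn₀
    rw [hCdef, mem_sdiff] at hposC
    obtain ⟨hposΛ, hposS⟩ := hposC
    rcases hk : x.1.pos with _ | k
    · rw [hk] at hposS; exact absurd hg hposS
    rw [hk] at hposΛ hposS
    have hkΛ : k ∈ Λ := Finset.some_mem_insertNone.1 hposΛ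
    -- the exit step is an edge `{k, w}` of the ghost graph
    have hT1 : (ewIter Eg rk F₀ {none} (ewInit (some v)) (nst F₀)).pos ∉ ({none} : Finset (Option V)) := by
      rw [← hx1, hk]; simp
    obtain ⟨hstep, haE, hpa, -, -, -⟩ := ewStep_traverse_spec (E := Eg) (rk := rk) hh₀ hT1 hA₀
    set a := Function.argminOn rk (↑(ewAvail Eg F₀ (ewIter Eg rk F₀ {none} (ewInit (some v)) (nst F₀))) : Set (Sym2 (Option V))) hA₀
      with ha
    have hw : x.2.pos = edgeOther x.1.pos a := by rw [hx2, ewIter_succ, hstep, hx1]; rfl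
    rw [← hx1, hk] at hpa
    rw [hk] at hw
    have hadj : (ghostGraph G Λ).Adj (some k) x.2.pos := by
      rw [hw]
      have := (mem_edgesIn_iff.1 haE).1
      rw [← mk_edgeOther_eq hpa, SimpleGraph.mem_edgeSet] at this
      exact this
    refine ⟨k, hkΛ, hposS, rfl, ?_, F₀, hF₀E, nst F₀, hx1.symm, hx2.symm, hx1 ▸ hh₀, hx1 ▸ hA₀⟩
    rcases hl : x.2.pos with _ | l
    · exact Or.inl rfl
    · right
      rw [hl, ghostGraph_adj_some_some] at hadj
      have hlΛ : l ∈ Λ := by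
        have := (mem_edgesIn_iff.1 haE).2 (edgeOther (some k) a) (edgeOther_mem hpa)
        rw [← hw, hl] at this
        exact Finset.some_mem_insertNone.1 this
      exact ⟨l, hlΛ, hadj, rfl⟩
  -- uniqueness of `k` for a signature
  have hsigk : ∀ x ∈ I, ∀ k : V, x.1.pos = some k →
      (x.2.pos = none ∨ ∃ l ∈ Λ, G.Adj k l ∧ x.2.pos = some l) ∧
      ∃ F₀ : Finset (Sym2 (Option V)), F₀ ⊆ Eg ∧ ∃ n₀ : ℕ,
        ewIter Eg rk F₀ {none} (ewInit (some v)) n₀ = x.1 ∧ ewIter Eg rk F₀ {none} (ewInit (some v)) (n₀ + 1) = x.2 ∧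
        x.1.halt = false ∧ (ewAvail Eg F₀ x.1).Nonempty := by
    intro x hx k hk
    obtain ⟨k', -, -, hk', hdich, hrest⟩ := hsig x hx
    rw [hk] at hk'
    cases Option.some_injective _ hk'
    exact ⟨hdich, hrest⟩
  -- the bound for a fixed exit vertex `k`
  have hk_bound : ∀ k ∈ Λ.filter (fun k => (some k : Option V) ∉ S),
      ∑ x ∈ I.filter (fun x => x.1.pos = some k), f x ≤
        gS[θ, Eg, ∅] * (bbKernel G Λ rk θ v k * (Real.tanh (θ (ghostEdge k)) +
          ∑ l ∈ Λ with G.Adj k l, Real.tanh (θ (liftEdge s(k, l))) * corrIn G Λ θ S {l})) := by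
    intro k hk
    set Ik := I.filter (fun x => x.1.pos = some k) with hIk
    set tk : Finset (Option V) := insert none ((Λ.filter (fun l => G.Adj k l)).image some) with htk
    have hmaps : ∀ x ∈ Ik, x.2.pos ∈ tk := by
      intro x hx
      rw [hIk, mem_filter] at hx
      obtain ⟨hdich, -⟩ := hsigk x hx.1 k hx.2
      rw [htk, mem_insert, mem_image]
      rcases hdich with h | ⟨l, hl, hadj, h⟩
      · exact Or.inl h
      · exact Or.inr ⟨l, mem_filter.2 ⟨hl, hadj⟩, h.symm⟩
    rw [← sum_fiberwise_of_maps_to hmaps f, htk, sum_insert (by simp), sum_image (by intro a _ b _ h; exact Option.some_injective _ h)]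
    -- the ghost exits
    have hX0 : ∀ x ∈ Ik.filter (fun x => x.2.pos = none), ∃ F₀ : Finset (Sym2 (Option V)), F₀ ⊆ Eg ∧ ∃ n₀ : ℕ,
        ewIter Eg rk F₀ {none} (ewInit (some v)) n₀ = x.1 ∧ ewIter Eg rk F₀ {none} (ewInit (some v)) (n₀ + 1) = x.2 ∧
        x.1.halt = false ∧ (ewAvail Eg F₀ x.1).Nonempty ∧ x.1.pos = some k ∧ x.2.pos = none := by
      intro x hx
      rw [mem_filter, hIk, mem_filter] at hx
      obtain ⟨-, F₀, hF₀, n₀, h1, h2, h3, h4⟩ := hsigk x hx.1.1 k hx.1.2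
      exact ⟨F₀, hF₀, n₀, h1, h2, h3, h4, hx.1.2, hx.2⟩
    have hghost : ∑ x ∈ Ik.filter (fun x => x.2.pos = none), f x ≤
        Real.tanh (θ (ghostEdge k)) * (bbKernel G Λ rk θ v k * gS[θ, Eg, ∅]) := by
      have h1 : ∑ x ∈ Ik.filter (fun x => x.2.pos = none), f x =
          ∑ x ∈ Ik.filter (fun x => x.2.pos = none), tw θ x.2.trav * gS[θ, Eg \ x.2.used, ∅] := by
        refine sum_congr rfl fun x hx => ?_
        rw [hf]; simp only
        rw [(mem_filter.1 hx).2]; simp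
      rw [h1, ghostEdge_apply]
      exact sum_exitPairs_le rk hθ hrk hv _ hX0
    -- the lattice exits
    have hlat : ∀ l ∈ Λ.filter (fun l => G.Adj k l),
        ∑ x ∈ Ik.filter (fun x => x.2.pos = some l), f x ≤
          Real.tanh (θ (liftEdge s(k, l))) * (bbKernel G Λ rk θ v k * gS[θ, Eg, ∅]) * corrIn G Λ θ S {l} := by
      intro l hl
      have hlΛ : l ∈ Λ := (mem_filter.1 hl).1
      have hXl : ∀ x ∈ Ik.filter (fun x => x.2.pos = some l), ∃ F₀ : Finset (Sym2 (Option V)), F₀ ⊆ Eg ∧ ∃ n₀ : ℕ,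
          ewIter Eg rk F₀ {none} (ewInit (some v)) n₀ = x.1 ∧ ewIter Eg rk F₀ {none} (ewInit (some v)) (n₀ + 1) = x.2 ∧
          x.1.halt = false ∧ (ewAvail Eg F₀ x.1).Nonempty ∧ x.1.pos = some k ∧ x.2.pos = some l := by
        intro x hx
        rw [mem_filter, hIk, mem_filter] at hx
        obtain ⟨-, F₀, hF₀, n₀, h1, h2, h3, h4⟩ := hsigk x hx.1.1 k hx.1.2
        exact ⟨F₀, hF₀, n₀, h1, h2, h3, h4, hx.1.2, hx.2⟩
      have h1 : ∑ x ∈ Ik.filter (fun x => x.2.pos = some l), f x =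
          (∑ x ∈ Ik.filter (fun x => x.2.pos = some l), tw θ x.2.trav * gS[θ, Eg \ x.2.used, ∅]) * corrIn G Λ θ S {l} := by
        rw [sum_mul]
        refine sum_congr rfl fun x hx => ?_
        rw [hf]; simp only
        rw [(mem_filter.1 hx).2]; simp
      rw [h1]
      have h2 := sum_exitPairs_le rk hθ hrk hv _ hXl (θ := θ)
      rw [← liftEdge_mk] at h2
      exact mul_le_mul_of_nonneg_right h2 (corrIn_nonneg hθ S (singleton_subset_iff.2 hlΛ))
    have hsum_lat := sum_le_sum hlat
    have hK := bbKernel_nonneg (G := G) (Λ := Λ) rk hθ v k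
    calc ∑ x ∈ Ik.filter (fun x => x.2.pos = none), f x +
          ∑ l ∈ Λ.filter (fun l => G.Adj k l), ∑ x ∈ Ik.filter (fun x => x.2.pos = some l), f x
        ≤ Real.tanh (θ (ghostEdge k)) * (bbKernel G Λ rk θ v k * gS[θ, Eg, ∅]) +
          ∑ l ∈ Λ.filter (fun l => G.Adj k l),
            Real.tanh (θ (liftEdge s(k, l))) * (bbKernel G Λ rk θ v k * gS[θ, Eg, ∅]) * corrIn G Λ θ S {l} :=
          add_le_add hghost hsum_lat
      _ = gS[θ, Eg, ∅] * (bbKernel G Λ rk θ v k * (Real.tanh (θ (ghostEdge k)) +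
          ∑ l ∈ Λ with G.Adj k l, Real.tanh (θ (liftEdge s(k, l))) * corrIn G Λ θ S {l})) := by
          rw [mul_add, mul_add, mul_sum, mul_sum]
          congr 1
          · ring
          · exact sum_congr rfl fun l _ => by ring
  -- regroup by `k`
  have hmapsk : ∀ x ∈ I, x.1.pos ∈ (Λ.filter (fun k => (some k : Option V) ∉ S)).image some := by
    intro x hx
    obtain ⟨k, hkΛ, hkS, hk, -, -⟩ := hsig x hx
    exact mem_image.2 ⟨k, mem_filter.2 ⟨hkΛ, hkS⟩, hk.symm⟩
  have hP23 : ∑ x ∈ I, f x ≤ gS[θ, Eg, ∅] * ∑ k ∈ Λ with (some k ∉ S), bbKernel G Λ rk θ v k *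
      (Real.tanh (θ (ghostEdge k)) + ∑ l ∈ Λ with G.Adj k l, Real.tanh (θ (liftEdge s(k, l))) * corrIn G Λ θ S {l}) := by
    rw [← sum_fiberwise_of_maps_to hmapsk f, sum_image (by intro a _ b _ h; exact Option.some_injective _ h), mul_sum]
    exact sum_le_sum hk_bound
  -- conclusion
  have htotal : thetaCorr G Λ θ {v} * gS[θ, Eg, ∅] ≤ gS[θ, Eg, ∅] * corrIn G Λ θ S {v} +
      gS[θ, Eg, ∅] * ∑ k ∈ Λ with (some k ∉ S), bbKernel G Λ rk θ v k *
        (Real.tanh (θ (ghostEdge k)) + ∑ l ∈ Λ with G.Adj k l, Real.tanh (θ (liftEdge s(k, l))) * corrIn G Λ θ S {l}) := by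
    rw [hlhs, hsplit]
    exact add_le_add hP1 (hP23a.trans hP23)
  rw [sub_le_iff_le_add]
  refine le_of_mul_le_mul_right ?_ hg0
  calc thetaCorr G Λ θ {v} * gS[θ, Eg, ∅] ≤ _ := htotal
    _ = _ := by ring

end Deficit

end Literature.Probability.LatticeModels
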